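import Literature.AnabelianGeometry.EtaleTheta.SettingModelChiKummerDataNondeg
import Literature.AnabelianGeometry.EtaleTheta.SettingModelCyclotomicCharacterInvariants
import Literature.AnabelianGeometry.EtaleTheta.ContH1ResInjective
import HarnessLib

/-!
# [EtTh] Rmk. 1.3.1 at the χ-twisted root model: `log(U)` has NO square root over `Y`
# (the denominators `½` are not superfluous — Kummer-class form at `ThetaSetting.modelχ`)

Mochizuki, *The étale theta function …*, Publ. RIMS **45** (2009) [EtTh], §1, Rmk. 1.3.1, PRIMS PDF p. 21
[cite: MochizukiEtTh2009, Rmk 1.3.1 p.21]: "the denominators `½` in Proposition 1.3 are by no means superfluous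
… the divisor `D₁` on `Ÿ` clearly does not descend to `Y`"; and Prop. 1.5, p. 23: "`log(Ü) := ½ · log(U)`",
"`F¹/F² = Ẑ · log(U)`", "`F̈¹/F̈² = Ẑ · log(Ü)`".

PROOF-ONLY companion (abc-iut cell, block F fact-proving wave, seat abc-iut-f-117 gen 4; instance-form CONTENT for the
FACT-LIST rows F-0523 `ThetaSetting.Rmk131` / F-2492 `ThetaSetting.Prop13` at the named datum; no `def`, no instance,
no Prop fact).  At abc-iut-L2-t1's χ-twisted root model `ThetaSetting.modelχ p` with abc-iut-w5-d171's Kummer data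
(`SettingModelChiKummerData.lean`, p433761: `logUχ` = the class of the `y`-coordinate cocycle `g ↦ c^{ŷ(g)}` on
`(Π^tp_Y)^Θ`, `logUddχ` = the class of `g ↦ c^{ŷ(g)/2}` on `(Π^tp_Ÿ)^Θ`, `res_logUχ : log(U)|_Ÿ = log(Ü)²`) we prove
the Kummer-class shadow of Rmk. 1.3.1:

* `SettingModel.logUχ_not_sq` — **`log(U) ∈ H¹((Π^tp_Y)^Θ, Δ_Θ)` is NOT a square**: there is no class `z` over `Y`
  with `z² = log(U)`, i.e. "`½ · log(U)`" does not exist over `Y` — although over `Ÿ` it does (`log(Ü)`,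
  `res_logUχ`).  So the passage to `Ÿ` (equivalently, the coefficient denominators `½Δ_Θ` of Prop. 1.3) is
  genuinely needed in the model, exactly as Rmk. 1.3.1 says of `D₁`.
* `SettingModel.logUχ_mul_kumY_not_sq` — the same for `log(U) · κ(u)` for EVERY Kummer class `κ(u)`,
  `u ∈ (ℚ̄_p^×)^{(Π^tp_Y)^Θ} ⊇ K^×` (Kummer cocycles of constants vanish at the geometric element `(b, 0) ⋊ 1`,
  `ThetaSetting.KummerCore.apply_eq_one_of_kumY_eq_mk`, the `Y`-twin of abc-iut-f-139's `…_of_kumYdd_eq_mk`), the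
  model form of the "up to the `O^×_{K/K̈}`-Kummer action" quantifier of `ThetaSetting.Rmk131`; more generally for
  `log(U) · w`, `w` any class with a representative vanishing there (`logUχ_mul_not_sq_of_apply_eq_one`).

* `SettingModel.logUddχ_not_mem_range_res` (appended) — **«`D₁` on `Ÿ` does not descend to `Y`» verbatim in
  Kummer-class form: `log(Ü)` is NOT the restriction of any class over `Y`**, because restriction
  `H¹((Π^tp_Y)^Θ, Δ_Θ) → H¹((Π^tp_Ÿ)^Θ, Δ_Θ)` is injective at the model (`res_gtpYdd_injective_modelχ`:
  `Δ_Θ ≅ Ẑ(χ)` has no `(Π^tp_Ÿ)^Θ`-invariants, abc-iut-w5-d091's `eq_one_of_forall_chi_apply_eq_of_isOpen` +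
  abc-iut-L2's `ContH1.res_injective_of_forall_fixed_eq_one'`) and a descent `w` would square to `log(U)`.

Mechanism (one line of arithmetic): a square root `z = [f]` would give, at the geometric element
`x = (b, 0) ⋊ 1 ∈ Π^tp_Y` — which centralises `Δ_Θ`, so that cohomologous cocycles AGREE at `x`
(`ContH1.apply_eq_of_mk_eq_mk_conj`, the `φ = id` case of abc-iut-f-139's `ContH1.apply_eq_of_mk_eq_mk`) — the identity `f(x)² = c^{ŷ(x)} = c^{ι(1)}` in `Δ_Θ ≅ Ẑ`
(`bijective_deltaThetaCoordχ`), i.e. `ι(1) ∈ 2Ẑ`, refuted mod `2` (`mem_range_sqHom_iff`, `modN_iotaZ`).  Over `Ÿ`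
the `y`-coordinate is even and the obstruction disappears.

HONEST FRAMING: a statement about the semi-synthetic χ-model (consistency evidence that the typed §1 interface
reproduces the `½`-phenomenon of Rmk. 1.3.1); it is NOT `ThetaSetting.Rmk131 E` for an étale-theta datum `E` (the
R78 F7b census, abc-iut-L2-t6) and asserts nothing of [EtTh]; no side is taken on [IUTchIII] Cor. 3.12;
typed ≠ proved.
-/

noncomputable section

open Topology

namespace Literature.AnabelianGeometry.EtaleTheta

open scoped IsMulCommutative

/-! ### Generic: representatives; trivial classes vanish at elements centralising the coefficients -/

namespace ContH1

variable {G G' : Type*} [Group G] [TopologicalSpace G]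
  [Group G'] [TopologicalSpace G'] [IsTopologicalGroup G']
  {φ : G →* G'} {A' : Subgroup G'} [A'.Normal] [IsMulCommutative A'] {H : Subgroup G}

/-- Every class of `H¹(H, A')` is the class of some continuous cocycle.
[cite: NeukirchSchmidtWingberg2008, I §2 and II §7] -/
theorem exists_mk_eq (z : ContH1 φ A' H) : ∃ (f : H → A') (hf : f ∈ contCocycles φ A' H), ContH1.mk f hf = z := by
  obtain ⟨⟨f, hf⟩, h⟩ := QuotientGroup.mk_surjective z
  exact ⟨f, hf, h⟩

/-- **Cohomologous cocycles for the conjugation action of `G'` on `A' ≤ G'` (`φ = id`) agree at every element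
centralising `A'`**: a principal crossed homomorphism `h ↦ (h a h⁻¹) · a⁻¹` vanishes there, so the VALUE at such an
element is an invariant of the class.  (The `φ = id` case — the one `ThetaSetting.H1Theta` uses — of abc-iut-f-139's
general `ContH1.apply_eq_of_mk_eq_mk` in `Discharge/Sec1Thm16Prop15ClosuresModelChi.lean`; restated at `id` so that
this file does not wait on that module's build.) [cite: NeukirchSchmidtWingberg2008, I §2 and II §7] -/
theorem apply_eq_of_mk_eq_mk_conj {K : Subgroup G'} {f g : K → A'}
    {hf : f ∈ contCocycles (MonoidHom.id G') A' K} {hg : g ∈ contCocycles (MonoidHom.id G') A' K}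
    (hfg : ContH1.mk f hf = ContH1.mk g hg) (x : K) (hx : ∀ a : A', MulAut.conjNormal (x : G') a = a) :
    f x = g x := by
  obtain ⟨a, ha⟩ := (ContH1.mk_eq_mk_iff K f g hf hg).mp hfg
  have h1 := ha x
  rw [MonoidHom.id_apply, hx a, mul_inv_cancel, inv_mul_eq_one] at h1
  exact h1

/-- In particular, for the conjugation action, a cocycle whose class is trivial VANISHES at every element
centralising the coefficients. [cite: NeukirchSchmidtWingberg2008, I §2 and II §7] -/
theorem apply_eq_one_of_mk_eq_one_conj {K : Subgroup G'} {f : K → A'}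
    {hf : f ∈ contCocycles (MonoidHom.id G') A' K} (hf1 : ContH1.mk f hf = 1)
    (x : K) (hx : ∀ a : A', MulAut.conjNormal (x : G') a = a) : f x = 1 := by
  rw [← ContH1.mk_one] at hf1
  exact apply_eq_of_mk_eq_mk_conj hf1 x hx

end ContH1

/-! ### Generic [EtTh] §1 brick: Kummer cocycles of constants vanish at geometric elements (over `Y`) -/

namespace ThetaSetting.KummerCore

variable {p : ℕ} [Fact p.Prime] {D : ThetaSetting p} (C : D.KummerCore)

/-- **Kummer cocycles of constants vanish at geometric elements — the `(Π^tp_Y)^Θ` twin** of abc-iut-f-139's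
`KummerCore.apply_eq_one_of_kumYdd_eq_mk` (`Discharge/Sec1Thm16Prop15ClosuresModelChi.lean`): for the Kummer data of a Kummer core, ANY cocycle representing the Kummer
class `κ(a) = kumY a` takes the value `1` at every `x ∈ (Π^tp_Y)^Θ` with `augTheta x = 1` that centralises `Δ_Θ`
(the Kummer cocycle `h ↦ c((h·a^{1/n}/a^{1/n})_n)` vanishes where `augTheta` does; the value at `x` is a class
invariant). [cite: MochizukiEtTh2009, Prop 1.3 p.21] -/
theorem apply_eq_one_of_kumY_eq_mk (a : ↥C.invY)
    {f : ↥(D.GtpY.map D.toTheta) → ↥D.DeltaTheta}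
    {hf : f ∈ contCocycles (MonoidHom.id D.GtpTheta) D.DeltaTheta (D.GtpY.map D.toTheta)}
    (h : C.toKummerData.kumY a = ContH1.mk f hf) (x : ↥(D.GtpY.map D.toTheta))
    (haug : C.augTheta (x : D.GtpTheta) = 1) (hcen : ∀ d : ↥D.DeltaTheta, MulAut.conjNormal (x : D.GtpTheta) d = d) :
    f x = 1 := by
  letI := D.unitsAction C.augTheta
  have h1 : C.toKummerData.kumY a =
      ContH1.mk (fun h => C.coeff.hom ((RootSystem.ofRootableBy (a : (PadicAlgCl p)ˣ)).kummerCocycle a.2 h))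
        (C.coeff.kummerContCocycle _ (RootSystem.ofRootableBy (a : (PadicAlgCl p)ˣ)) a.2
          (fun _ => C.isOpen_stabilizer' _)).2 := rfl
  rw [h1] at h
  have h2 := ContH1.apply_eq_of_mk_eq_mk_conj h x hcen
  rw [← h2]
  have h3 : (RootSystem.ofRootableBy (a : (PadicAlgCl p)ˣ)).kummerCocycle a.2 x = 1 := by
    refine Subtype.ext (funext fun n => ?_)
    rw [RootSystem.kummerCocycle_apply]
    change C.augTheta (x : D.GtpTheta) • (RootSystem.ofRootableBy (a : (PadicAlgCl p)ˣ)).root n /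
      (RootSystem.ofRootableBy (a : (PadicAlgCl p)ˣ)).root n = _
    rw [haug, one_smul, div_self']
    rfl
  rw [h3, map_one]

end ThetaSetting.KummerCore

namespace SettingModel

open Literature.AnabelianGeometry.SemiGraphs

variable (p : ℕ) [Fact p.Prime]

/-! ### The parity obstruction in `Ẑ` -/

/-- `ι(1) ∉ 2Ẑ`: the image of `1 ∈ ℤ` in `Ẑ` is not a square (reduce mod `2`). [cite: RibesZalesskii2010, Thm 2.7.1] -/
theorem iotaZ_one_not_mem_range_sqHom : iotaZ (Multiplicative.ofAdd 1) ∉ sqHom.range := by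
  rw [mem_range_sqHom_iff, modN_iotaZ, toAdd_ofAdd, ofAdd_eq_one]
  decide

/-- Hence `s² ≠ ι(1)` for every `s ∈ Ẑ`. [cite: RibesZalesskii2010, Thm 2.7.1] -/
theorem sq_ne_iotaZ_one (s : ZH) : s ^ 2 ≠ iotaZ (Multiplicative.ofAdd 1) := fun h =>
  iotaZ_one_not_mem_range_sqHom ⟨s, h⟩

/-- In `Δ_Θ(modelχ) ≅ Ẑ`: no element squares to `c = c^{ι(1)}`. [cite: MochizukiEtTh2009, §1 p.12] -/
theorem sq_ne_deltaThetaCoordχ_iotaZ_one (d : (CurveTheta.thetaToEll (curveχ p)).ker) :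
    d ^ 2 ≠ deltaThetaCoordχ p (iotaZ (Multiplicative.ofAdd 1)) := by
  obtain ⟨s, rfl⟩ := (bijective_deltaThetaCoordχ p).2 d
  rw [← map_pow]
  exact fun h => sq_ne_iotaZ_one s ((bijective_deltaThetaCoordχ p).1 h)

/-! ### The geometric test element `x = (b, 0) ⋊ 1 ∈ (Π^tp_Y)^Θ` -/

/-- The image in `(Π^tp_X)^Θ` of the geometric element `(b, 0) ⋊ 1` lies in `(Π^tp_Y)^Θ`.
[cite: MochizukiEtTh2009, §1 p.13] -/
theorem toTheta_inl_b_mem_gtpY_map :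
    CurveTheta.toTheta (curveχ p) (SemidirectProduct.inl (bPowGfp (iotaZ (Multiplicative.ofAdd 1)))) ∈
      (ThetaSetting.modelχ p).GtpY.map (ThetaSetting.modelχ p).toTheta :=
  ⟨_, inl_bPowGfp_mem_gtpY p _, rfl⟩

/-- It centralises `Δ_Θ` (it lies in the image of `Δ^tp_X`). [cite: MochizukiEtTh2009, §1 p.12] -/
theorem conjNormal_toTheta_inl_b (a : (ThetaSetting.modelχ p).DeltaTheta) :
    MulAut.conjNormal
        ((⟨_, toTheta_inl_b_mem_gtpY_map p⟩ :
            ↥((ThetaSetting.modelχ p).GtpY.map (ThetaSetting.modelχ p).toTheta)) :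
          (ThetaSetting.modelχ p).GtpTheta) a = a :=
  conjNormal_toTheta_eq_self p (SemidirectProduct.right_inl _) a

/-- The `log(U)`-cocycle takes the value `c^{ι(1)} = c` at `x = (b, 0) ⋊ 1` (`ŷ(x) = 1`).
[cite: MochizukiEtTh2009, Prop 1.5 p.23] -/
theorem logUFunχ_inl_b :
    logUFunχ p _ ⟨_, toTheta_inl_b_mem_gtpY_map p⟩ = deltaThetaCoordχ p (iotaZ (Multiplicative.ofAdd 1)) := by
  show deltaThetaCoordχ p (yThetaχ p (CurveTheta.toTheta (curveχ p) _)) = _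
  rw [yThetaχ_toTheta, yCoordχ_inl_bPowGfp]

/-! ### `log(U)` is not a square over `Y` -/

/-- **Rmk. 1.3.1 at the χ-model, cocycle form**: no continuous cocycle `f` on `(Π^tp_Y)^Θ` has `[f]² = log(U)` —
at `x = (b, 0) ⋊ 1` it would give `f(x)² = c`, and `c` is not a square in `Δ_Θ ≅ Ẑ`.
[cite: MochizukiEtTh2009, Rmk 1.3.1 p.21] -/
theorem mk_sq_ne_logUχ (f : ↥((ThetaSetting.modelχ p).GtpY.map (ThetaSetting.modelχ p).toTheta) →
      (ThetaSetting.modelχ p).DeltaTheta)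
    (hf : f ∈ contCocycles (MonoidHom.id (ThetaSetting.modelχ p).GtpTheta) (ThetaSetting.modelχ p).DeltaTheta
      ((ThetaSetting.modelχ p).GtpY.map (ThetaSetting.modelχ p).toTheta)) :
    ContH1.mk f hf ^ 2 ≠ logUχ p := by
  intro h
  rw [pow_two, ContH1.mk_mul_mk, logUχ] at h
  have key := ContH1.apply_eq_of_mk_eq_mk_conj h ⟨_, toTheta_inl_b_mem_gtpY_map p⟩ (conjNormal_toTheta_inl_b p)
  rw [Pi.mul_apply, logUFunχ_inl_b, ← pow_two] at key
  exact sq_ne_deltaThetaCoordχ_iotaZ_one p _ key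

/-- **Rmk. 1.3.1 at the χ-model («the denominators `½` are by no means superfluous»)**: the Kummer class
`log(U) ∈ H¹((Π^tp_Y)^Θ, Δ_Θ)` of the coordinate has NO square root over `Y` — "`½ · log(U)`" does not exist in
`H¹((Π^tp_Y)^Θ, Δ_Θ)` — although its restriction to `Ÿ` is the square `log(Ü)²` (`res_logUχ`).
[cite: MochizukiEtTh2009, Rmk 1.3.1 p.21] -/
theorem logUχ_not_sq
    (z : (ThetaSetting.modelχ p).H1Theta ((ThetaSetting.modelχ p).GtpY.map (ThetaSetting.modelχ p).toTheta)) :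
    z ^ 2 ≠ logUχ p := by
  obtain ⟨f, hf, rfl⟩ := ContH1.exists_mk_eq z
  exact mk_sq_ne_logUχ p f hf

/-- Equivalently: `log(U)` is not in the image of the squaring endomorphism of `H¹((Π^tp_Y)^Θ, Δ_Θ)`.
[cite: MochizukiEtTh2009, Rmk 1.3.1 p.21] -/
theorem logUχ_not_mem_range_sq :
    logUχ p ∉ Set.range (fun z :
      (ThetaSetting.modelχ p).H1Theta ((ThetaSetting.modelχ p).GtpY.map (ThetaSetting.modelχ p).toTheta) =>
        z ^ 2) := by
  rintro ⟨z, hz⟩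
  exact logUχ_not_sq p z hz

/-- … while over `Ÿ` the restricted class IS a square (`log(U)|_Ÿ = log(Ü)²`): the obstruction is exactly the
descent from `Ÿ` to `Y`. [cite: MochizukiEtTh2009, Prop 1.5 p.23] -/
theorem res_logUχ_mem_range_sq :
    ContH1.res (MonoidHom.id (ThetaSetting.modelχ p).GtpTheta) (ThetaSetting.modelχ p).DeltaTheta
        (ThetaSetting.modelχ p).GtpYddTheta_le (logUχ p) ∈
      Set.range (fun z :
        (ThetaSetting.modelχ p).H1Theta ((ThetaSetting.modelχ p).GtpYdd.map (ThetaSetting.modelχ p).toTheta) =>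
          z ^ 2) :=
  ⟨logUddχ p, (res_logUχ p).symm⟩

/-- The Kummer datum of the χ-model therefore has `logU` WITHOUT a square root over `Y` and `logUdd` AS its square
root over `Ÿ`. [cite: MochizukiEtTh2009, Prop 1.5 p.23] -/
theorem kummerDataχ_logU_not_sq
    (z : (ThetaSetting.modelχ p).H1Theta ((ThetaSetting.modelχ p).GtpY.map (ThetaSetting.modelχ p).toTheta)) :
    z ^ 2 ≠ (kummerDataχ p).logU :=
  logUχ_not_sq p z

/-! ### The twisted form: `log(U) · w` for classes `w` vanishing at the geometric element -/

/-- **Twisted form**: for every class `w = [g]` whose cocycle VANISHES at `x = (b, 0) ⋊ 1` (e.g. every class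
inflated from the Galois quotient — the Kummer classes of `K^×` — since `x` has trivial Galois component), the
class `log(U) · w` still has no square root over `Y`.  This is the model form of the quantifier "up to the
`O^×_{K/K̈}`-Kummer action" in `ThetaSetting.Rmk131`. [cite: MochizukiEtTh2009, Rmk 1.3.1 p.21] -/
theorem logUχ_mul_mk_not_sq
    (g : ↥((ThetaSetting.modelχ p).GtpY.map (ThetaSetting.modelχ p).toTheta) → (ThetaSetting.modelχ p).DeltaTheta)
    (hg : g ∈ contCocycles (MonoidHom.id (ThetaSetting.modelχ p).GtpTheta) (ThetaSetting.modelχ p).DeltaTheta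
      ((ThetaSetting.modelχ p).GtpY.map (ThetaSetting.modelχ p).toTheta))
    (hgx : g ⟨_, toTheta_inl_b_mem_gtpY_map p⟩ = 1)
    (z : (ThetaSetting.modelχ p).H1Theta ((ThetaSetting.modelχ p).GtpY.map (ThetaSetting.modelχ p).toTheta)) :
    z ^ 2 ≠ logUχ p * ContH1.mk g hg := by
  obtain ⟨f, hf, rfl⟩ := ContH1.exists_mk_eq z
  intro h
  rw [pow_two, ContH1.mk_mul_mk, logUχ, ContH1.mk_mul_mk] at h
  have key := ContH1.apply_eq_of_mk_eq_mk_conj h ⟨_, toTheta_inl_b_mem_gtpY_map p⟩ (conjNormal_toTheta_inl_b p)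
  erw [Pi.mul_apply, Pi.mul_apply] at key
  erw [logUFunχ_inl_b, hgx, mul_one, ← pow_two] at key
  exact sq_ne_deltaThetaCoordχ_iotaZ_one p _ key

/-- Class-level version of the twisted form: if SOME representative of `w` vanishes at `x = (b, 0) ⋊ 1` (the value
at `x` is an invariant of the class, `ContH1.apply_eq_of_mk_eq_mk_conj`), then `log(U) · w` is not a square over `Y`.
[cite: MochizukiEtTh2009, Rmk 1.3.1 p.21] -/
theorem logUχ_mul_not_sq_of_apply_eq_one
    (w z : (ThetaSetting.modelχ p).H1Theta ((ThetaSetting.modelχ p).GtpY.map (ThetaSetting.modelχ p).toTheta))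
    (hw : ∃ (g : _ → (ThetaSetting.modelχ p).DeltaTheta) (hg : g ∈ contCocycles _ _ _),
      ContH1.mk g hg = w ∧ g ⟨_, toTheta_inl_b_mem_gtpY_map p⟩ = 1) :
    z ^ 2 ≠ logUχ p * w := by
  obtain ⟨g, hg, rfl, hgx⟩ := hw
  exact logUχ_mul_mk_not_sq p g hg hgx z

/-- `augTheta` vanishes at the geometric test element `x = (b, 0) ⋊ 1` (its Galois component is trivial).
[cite: MochizukiEtTh2009, §1 p.12] -/
theorem augTheta_kummerCoreχ_inl_b :
    (kummerCoreχ p).augTheta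
        ((⟨_, toTheta_inl_b_mem_gtpY_map p⟩ :
            ↥((ThetaSetting.modelχ p).GtpY.map (ThetaSetting.modelχ p).toTheta)) :
          (ThetaSetting.modelχ p).GtpTheta) = 1 :=
  (kummerCoreχ p).augTheta_toTheta _

/-- **Rmk. 1.3.1 at the χ-model, up to the Kummer action («`O^×_{K/K̈} · η^Θ`»)**: for EVERY Kummer class
`κ(u) = kumY u` of the model's Kummer data (`u` any `(Π^tp_Y)^Θ`-invariant unit of `ℚ̄_p`, in particular every
`u ∈ K^×`), the class `log(U) · κ(u)` has NO square root over `Y`.  [cite: MochizukiEtTh2009, Rmk 1.3.1 p.21] -/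
theorem logUχ_mul_kumY_not_sq (u : ↥(kummerCoreχ p).invY)
    (z : (ThetaSetting.modelχ p).H1Theta ((ThetaSetting.modelχ p).GtpY.map (ThetaSetting.modelχ p).toTheta)) :
    z ^ 2 ≠ logUχ p * (kummerDataχ p).kumY u := by
  obtain ⟨g, hg, hgeq⟩ := ContH1.exists_mk_eq ((kummerDataχ p).kumY u)
  rw [← hgeq]
  refine logUχ_mul_mk_not_sq p g hg ?_ z
  exact (kummerCoreχ p).apply_eq_one_of_kumY_eq_mk u hgeq.symm ⟨_, toTheta_inl_b_mem_gtpY_map p⟩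
    (augTheta_kummerCoreχ_inl_b p) (conjNormal_toTheta_inl_b p)

/-- The same with the Kummer class of a unit of `K` (`K^× → (K^×)^∧ →κ H¹`): `log(U) · κ(u)`, `u ∈ K^×`, is not a
square over `Y`. [cite: MochizukiEtTh2009, Rmk 1.3.1 p.21] -/
theorem logUχ_mul_kumY_toKHat_not_sq (u : (↥(ThetaSetting.modelχ p).K)ˣ)
    (z : (ThetaSetting.modelχ p).H1Theta ((ThetaSetting.modelχ p).GtpY.map (ThetaSetting.modelχ p).toTheta)) :
    z ^ 2 ≠ logUχ p * (kummerDataχ p).kumY ((kummerDataχ p).toKHat u) :=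
  logUχ_mul_kumY_not_sq p _ z

/-- In particular `log(U) · log(U)^{2k}`-type rescalings do not help either: `log(U)^(2k+1)` is never a square
(odd powers of `c` are not squares in `Ẑ`-coordinates is NOT needed — the case `k = 0` is `logUχ_not_sq`; here the
general odd power follows from the group law). [cite: MochizukiEtTh2009, Rmk 1.3.1 p.21] -/
theorem logUχ_zpow_odd_not_sq (k : ℤ)
    (z : (ThetaSetting.modelχ p).H1Theta ((ThetaSetting.modelχ p).GtpY.map (ThetaSetting.modelχ p).toTheta)) :
    z ^ 2 ≠ logUχ p ^ (2 * k + 1) := by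
  intro h
  apply logUχ_not_sq p (z * (logUχ p ^ k)⁻¹)
  rw [mul_pow, inv_pow, h, ← zpow_natCast, ← zpow_mul]
  group

/-! ### «`D₁` on `Ÿ` does not descend to `Y`»: `log(Ü)` is not the restriction of a class over `Y`
(appended 2026-08-26, same seat) -/

/-- **`Δ_Θ(modelχ)` has no non-trivial element fixed by `(Π^tp_Ÿ)^Θ`**: conjugation by `(Π^tp_Ÿ)^Θ` on
`Δ_Θ ≅ Ẑ(χ)` runs through `χ(G_K̈)` (`deltaThetaCoordχ_chi`, `KummerCore.map_augTheta_gtpYdd`), and `Ẑ(χ)` has no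
invariants under the open subgroup `G_K̈ ≤ G_{ℚ_p}` (abc-iut-w5-d091's `eq_one_of_forall_chi_apply_eq_of_isOpen`,
Neukirch II (5.7)). [cite: MochizukiEtTh2009, §1 p.12] -/
theorem deltaTheta_eq_one_of_forall_gtpYdd_conj_eq (a : (ThetaSetting.modelχ p).DeltaTheta)
    (ha : ∀ n : (ThetaSetting.modelχ p).GtpTheta,
      n ∈ (ThetaSetting.modelχ p).GtpYdd.map (ThetaSetting.modelχ p).toTheta → MulAut.conjNormal n a = a) :
    a = 1 := by
  obtain ⟨t, rfl⟩ := (bijective_deltaThetaCoordχ p).2 a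
  haveI := (kummerCoreχ p).finiteDimensional_Kdd
  have ht : t = 1 := by
    refine eq_one_of_forall_chi_apply_eq_of_isOpen p (ThetaSetting.modelχ p).Kdd.fixingSubgroup
      (IntermediateField.fixingSubgroup_isOpen _) fun σ hσ => ?_
    rw [← (kummerCoreχ p).map_augTheta_gtpYdd] at hσ
    obtain ⟨n, hn, rfl⟩ := hσ
    apply (bijective_deltaThetaCoordχ p).1
    rw [show (kummerCoreχ p).augTheta n = CurveTheta.augTheta (curveχ p) n from rfl, deltaThetaCoordχ_chi]
    exact ha n hn
  rw [ht]
  exact map_one (deltaThetaCoordχ p)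

/-- Hence **restriction `H¹((Π^tp_Y)^Θ, Δ_Θ) → H¹((Π^tp_Ÿ)^Θ, Δ_Θ)` is INJECTIVE at the χ-model** (inflation–restriction:
`H¹(Gal(Ÿ/Y), Δ_Θ^{(Π^tp_Ÿ)^Θ}) = H¹(–, 1) = 0`; abc-iut-L2's `ContH1.res_injective_of_forall_fixed_eq_one'`).
[cite: MochizukiEtTh2009, Prop 1.5 p.23] -/
theorem res_gtpYdd_injective_modelχ :
    Function.Injective (ContH1.res (MonoidHom.id (ThetaSetting.modelχ p).GtpTheta) (ThetaSetting.modelχ p).DeltaTheta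
      (ThetaSetting.modelχ p).GtpYddTheta_le) := by
  haveI := (ThetaSetting.modelχ p).compat.GtpYddTheta_normal
  exact ContH1.res_injective_of_forall_fixed_eq_one' _ fun a ha =>
    deltaTheta_eq_one_of_forall_gtpYdd_conj_eq p a fun n hn => by simpa only [MonoidHom.id_apply] using ha n hn

/-- **Rmk. 1.3.1 at the χ-model, descent form («the divisor `D₁` on `Ÿ` clearly does not descend to `Y`»)**: the
class `log(Ü) = ½·log(U) ∈ H¹((Π^tp_Ÿ)^Θ, Δ_Θ)` is NOT the restriction of ANY class on `(Π^tp_Y)^Θ` — a class `w`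
over `Y` with `w|_Ÿ = log(Ü)` would satisfy `(w²)|_Ÿ = log(U)|_Ÿ`, hence `w² = log(U)` by the injectivity of
restriction, contradicting `logUχ_not_sq`. [cite: MochizukiEtTh2009, Rmk 1.3.1 p.21] -/
theorem logUddχ_not_mem_range_res :
    logUddχ p ∉ Set.range (ContH1.res (MonoidHom.id (ThetaSetting.modelχ p).GtpTheta)
      (ThetaSetting.modelχ p).DeltaTheta (ThetaSetting.modelχ p).GtpYddTheta_le) := by
  rintro ⟨w, hw⟩
  refine logUχ_not_sq p w (res_gtpYdd_injective_modelχ p ?_)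
  rw [map_pow, hw, res_logUχ]

/-- Pointwise form: no class over `Y` restricts to `log(Ü)`. [cite: MochizukiEtTh2009, Rmk 1.3.1 p.21] -/
theorem res_ne_logUddχ
    (w : (ThetaSetting.modelχ p).H1Theta ((ThetaSetting.modelχ p).GtpY.map (ThetaSetting.modelχ p).toTheta)) :
    ContH1.res (MonoidHom.id (ThetaSetting.modelχ p).GtpTheta) (ThetaSetting.modelχ p).DeltaTheta
      (ThetaSetting.modelχ p).GtpYddTheta_le w ≠ logUddχ p :=
  fun h => logUddχ_not_mem_range_res p ⟨w, h⟩

/-- The two readings of Rmk. 1.3.1 at the χ-model are EQUIVALENT for any class `v` over `Ÿ` with `v² = log(U)|_Ÿ`: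
`v` descends to `Y` iff `log(U)` is a square over `Y` (restriction is injective). Applied to `v = log(Ü)` both sides
are false. [cite: MochizukiEtTh2009, Rmk 1.3.1 p.21] -/
theorem mem_range_res_iff_of_sq_eq_res_logUχ
    (v : (ThetaSetting.modelχ p).H1Theta ((ThetaSetting.modelχ p).GtpYdd.map (ThetaSetting.modelχ p).toTheta))
    (hv : v ^ 2 = ContH1.res (MonoidHom.id (ThetaSetting.modelχ p).GtpTheta) (ThetaSetting.modelχ p).DeltaTheta
      (ThetaSetting.modelχ p).GtpYddTheta_le (logUχ p)) :
    v ∈ Set.range (ContH1.res (MonoidHom.id (ThetaSetting.modelχ p).GtpTheta) (ThetaSetting.modelχ p).DeltaTheta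
      (ThetaSetting.modelχ p).GtpYddTheta_le) ↔
    ∃ w : (ThetaSetting.modelχ p).H1Theta ((ThetaSetting.modelχ p).GtpY.map (ThetaSetting.modelχ p).toTheta),
      w ^ 2 = logUχ p := by
  constructor
  · rintro ⟨w, rfl⟩
    exact ⟨w, res_gtpYdd_injective_modelχ p (by rw [map_pow, hv])⟩
  · rintro ⟨w, hw⟩
    exact absurd hw (logUχ_not_sq p w)

/-- The Kummer datum of the χ-model: `logUdd` is not a restricted class although `logU|_Ÿ = logUdd²`.
[cite: MochizukiEtTh2009, Prop 1.5 p.23] -/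
theorem kummerDataχ_logUdd_not_mem_range_res :
    (kummerDataχ p).logUdd ∉ Set.range (ContH1.res (MonoidHom.id (ThetaSetting.modelχ p).GtpTheta)
      (ThetaSetting.modelχ p).DeltaTheta (ThetaSetting.modelχ p).GtpYddTheta_le) :=
  logUddχ_not_mem_range_res p

end SettingModel

end Literature.AnabelianGeometry.EtaleTheta

end
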